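import Literature.MathematicalPhysics.QuantumFieldTheory.Balaban1983to89.T4AxialGaugeSmallField
import HarnessLib

/-!
# Crux `HistoryTailL` (stmt-QuantumFields-19936), line #13 height one — K1♭ (A): a LOCAL, GAUGE-INVARIANT, LIPSCHITZ observable on a
# non-wrapping box is controlled by the box plaquettes (torus non-abelian Poincaré lemma + locality)

Cell `ym3-torus` (YM ladder rung R3 = continuum SU(2) Yang–Mills on the 3-torus — NOT d = 4, NOT infinite volume, NOT a mass gap, NOT the Clay
problem), width seat `ym-ust-19936-w7` gen 10, LEAD ★w1-19936 g8 WORD 1 «K1♭ GO» (03:14Z); `--supports stmt-QuantumFields-19936 --as helper`.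

A STANDALONE, REUSABLE LETTER (LEAD WORDS 7∕8, 03:33∕03:39Z): the deterministic «box axial-gauge Lipschitz ∕ Poincaré» bookkeeping for
gauge-invariant LOCAL observables, `Params`-generic, every gauge group — the deterministic half of the crude route «axial gauge on the box + union
bound» from the PREFACTOR-FREE level-0 plaquette tail (`…LocalInsertionLevelZeroUniformSU2T3`) to Gaussian concentration on boxes of BOUNDED side
(`…LocalInsertionBoxConcentrationBounded`, the text of `MesoscopicConcentrationL` — stmt-QuantumFields-23532, route PoincareLipschitz, NOT claimed, NOT
restated — with the extra guard `n ≤ N₀`).  HONEST: its originally intended consumer (the K1-road to height one) was superseded the same hour by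
★w4 g11's direct `stub_insertionHeightOne`; the letter is kept for ALIGN ∕ band-transport ∕ future concentration pens.  With the tree's torus axial
gauge `T4AxialGaugeSmallField.axialGauge` (NOT re-proved) and the K1 box «`(y k − x₀ k).val < n` for every coordinate `k`» (corner `x₀`, side `n`,
`2n ≤ sitesPerDir`):

* §1 `castSite_val_eq`, `eq_castSite_of_val_lt`, ★`mem_boxBonds_of_val_lt`, `val_lt_of_mem_boxPlaqs` — the dictionary between the K1 box and the
  integer boxes `boxBonds ∕ boxPlaqs lo (lo + (n − 1))`, `lo κ := (x₀ κ).val`;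
* §2 `card_filter_bond_box_le` (`≤ d·n^d`), `card_filter_plaq_box_le` (`≤ d²·n^d`) — the counts;
* §3 ★★`abs_sub_apply_one_le_of_box_plaqSmall`: for `f` gauge invariant, depending only on the bonds of the box and `Λ`-Lipschitz in the `ℓ²`
  link metric `√(Σ_b dist1(U_b U′_b⁻¹)²)`, if every plaquette based in the box is within `δ` of `1` then
  `|f U − f 1| ≤ Λ · (√(d·n^d) · ((d − 1)(n − 1))) · δ` (axial gauge ⇒ every box bond within `(d−1)(n−1)δ` of `1`; truncate off the box by
  locality; compare with the trivial field by the Lipschitz bound).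
THEOREMS ONLY, definition-free; [folklore] lattice bookkeeping around [Balaban1985Averaging] (19)–(20); nothing of K1, the stubs or the crux is proved.
-/

set_option autoImplicit false

noncomputable section

open scoped BigOperators
open Literature.MathematicalPhysics.QuantumFieldTheory.Balaban1983to89
open Literature.MathematicalPhysics.QuantumFieldTheory.Balaban1983to89.T4AxialGaugeSmallField
  (castSite castSite_apply boxPlaqs boxBonds axialGauge dist1_gaugeAct_axialGauge_le_of_mem_boxBonds)
open Literature.MathematicalPhysics.QuantumFieldTheory.Balaban1983to89.B7Prop1Explicit (e e_apply)

namespace Summit.QuantumFields.YangMills.Theorems.LocalInsertion.BoxAxialLipschitz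

variable {P : Params} {j : ℕ}

/-! ## §1 The K1 box versus the integer boxes of `T4AxialGaugeSmallField` -/

/-- The integer corner `lo κ := (x₀ κ).val` projects back to `x₀`. [folklore] -/
theorem castSite_val_eq (x₀ : Site P j) : (castSite (fun κ => ((x₀ κ).val : ℤ)) : Site P j) = x₀ := by
  funext κ
  rw [castSite_apply, Int.cast_natCast, ZMod.natCast_zmod_val]

/-- A site of the K1 box is the projection of `lo + (its offsets)`. [folklore] -/
theorem eq_castSite_of_val_lt (x₀ y : Site P j) :
    y = castSite (fun κ => ((x₀ κ).val : ℤ) + (((y κ - x₀ κ).val : ℕ) : ℤ)) := by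
  funext κ
  rw [castSite_apply, Int.cast_add, Int.cast_natCast, Int.cast_natCast, ZMod.natCast_zmod_val, ZMod.natCast_zmod_val]
  abel

/-- ★ **A bond of the K1 box is a bond of the integer box `[lo, lo + (n − 1)]`** (`2n ≤ sitesPerDir`: the target condition forbids the wrap, so the
source offset in the bond's direction is `≤ n − 2`). [folklore] -/
theorem mem_boxBonds_of_val_lt (x₀ : Site P j) {n : ℕ} (hn : 1 ≤ n) (h2n : 2 * n ≤ P.sitesPerDir j) (b : PBond P j)
    (hs : ∀ k, (b.src k - x₀ k).val < n) (ht : ∀ k, (b.tgt k - x₀ k).val < n) :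
    b ∈ boxBonds (fun κ => ((x₀ κ).val : ℤ)) (fun κ => ((x₀ κ).val : ℤ) + ((n - 1 : ℕ) : ℤ)) := by
  refine ⟨fun κ => ((x₀ κ).val : ℤ) + (((b.src κ - x₀ κ).val : ℕ) : ℤ), fun κ => ?_, fun κ => ?_, eq_castSite_of_val_lt x₀ b.src⟩
  · show ((x₀ κ).val : ℤ) ≤ ((x₀ κ).val : ℤ) + (((b.src κ - x₀ κ).val : ℕ) : ℤ)
    linarith [Int.natCast_nonneg ((b.src κ - x₀ κ).val)]
  · show ((x₀ κ).val : ℤ) + (((b.src κ - x₀ κ).val : ℕ) : ℤ) + e b.dir κ ≤ ((x₀ κ).val : ℤ) + ((n - 1 : ℕ) : ℤ)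
    rw [e_apply]
    by_cases hκ : κ = b.dir
    · subst hκ
      rw [if_pos rfl]
      -- the target offset in direction `dir` is the source offset `+ 1`, and it is `< n`
      have htgt : b.tgt b.dir - x₀ b.dir = (b.src b.dir - x₀ b.dir) + 1 := by
        rw [PBond.tgt, Site.shift_apply, if_pos rfl]; ring
      have hlt : (b.src b.dir - x₀ b.dir).val + 1 < P.sitesPerDir j := by have := hs b.dir; omega
      have hva : ((b.src b.dir - x₀ b.dir) + 1).val = (b.src b.dir - x₀ b.dir).val + 1 := by
        have h1' : (1 : ZMod (P.sitesPerDir j)).val = 1 := by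
          have : Fact (1 < P.sitesPerDir j) := ⟨by omega⟩
          exact ZMod.val_one _
        rw [ZMod.val_add_of_lt (by rw [h1']; exact hlt), h1']
      have h1 := ht b.dir
      rw [htgt, hva] at h1
      have h2 : (((b.src b.dir - x₀ b.dir).val : ℕ) : ℤ) + 1 ≤ ((n - 1 : ℕ) : ℤ) := by
        rw [Nat.cast_sub hn]; push_cast; exact_mod_cast (by omega : ((b.src b.dir - x₀ b.dir).val : ℤ) + 1 ≤ (n : ℤ) - 1)
      linarith
    · rw [if_neg hκ, add_zero]
      have h1 := hs κ
      have h2 : (((b.src κ - x₀ κ).val : ℕ) : ℤ) ≤ ((n - 1 : ℕ) : ℤ) := by exact_mod_cast (by omega : (b.src κ - x₀ κ).val ≤ n - 1)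
      linarith

/-- A plaquette of the integer box `[lo, lo + (n − 1)]` is based in the K1 box. [folklore] -/
theorem val_lt_of_mem_boxPlaqs (x₀ : Site P j) {n : ℕ} (hn : 1 ≤ n) (h2n : 2 * n ≤ P.sitesPerDir j) {q : Plaq P j}
    (hq : q ∈ boxPlaqs (fun κ => ((x₀ κ).val : ℤ)) (fun κ => ((x₀ κ).val : ℤ) + ((n - 1 : ℕ) : ℤ))) (k : Fin P.d) :
    (q.src k - x₀ k).val < n := by
  obtain ⟨z, hlo, hhi, hsrc⟩ := hq
  have h0 : 0 ≤ z k - ((x₀ k).val : ℤ) := by have := hlo k; linarith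
  have h1 : z k - ((x₀ k).val : ℤ) ≤ ((n - 1 : ℕ) : ℤ) := by
    have := hhi k
    simp only [Pi.add_apply, e_apply] at this
    split_ifs at this <;> linarith
  have hdiff : q.src k - x₀ k = (((z k - ((x₀ k).val : ℤ)) : ℤ) : ZMod (P.sitesPerDir j)) := by
    rw [hsrc, castSite_apply, Int.cast_sub, Int.cast_natCast, ZMod.natCast_zmod_val]
  rw [hdiff]
  have hN : z k - ((x₀ k).val : ℤ) < (P.sitesPerDir j : ℤ) := by
    have : ((n - 1 : ℕ) : ℤ) < (P.sitesPerDir j : ℤ) := by exact_mod_cast (by omega : n - 1 < P.sitesPerDir j)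
    linarith
  have hval : (((((z k - ((x₀ k).val : ℤ)) : ℤ) : ZMod (P.sitesPerDir j))).val : ℤ) = z k - ((x₀ k).val : ℤ) := by
    rw [ZMod.val_intCast, Int.emod_eq_of_lt h0 hN]
  have hlt : z k - ((x₀ k).val : ℤ) < (n : ℤ) := by
    have : ((n - 1 : ℕ) : ℤ) < (n : ℤ) := by exact_mod_cast (by omega : n - 1 < n)
    linarith
  have h2 : (((((z k - ((x₀ k).val : ℤ)) : ℤ) : ZMod (P.sitesPerDir j))).val : ℤ) < (n : ℤ) := by rw [hval]; exact hlt
  exact_mod_cast h2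

/-! ## §2 Counting the bonds and plaquettes of the box -/

/-- The bonds with source in the K1 box number at most `d · n^d`. [folklore] -/
theorem card_filter_bond_box_le (x₀ : Site P j) (n : ℕ) [DecidablePred fun b : PBond P j => ∀ k, (b.src k - x₀ k).val < n] :
    (Finset.univ.filter fun b : PBond P j => ∀ k, (b.src k - x₀ k).val < n).card ≤ P.d * n ^ P.d := by
  classical
  set T : Finset (Fin P.d × (Fin P.d → ℕ)) := Finset.univ ×ˢ Fintype.piFinset fun _ => Finset.range n with hT
  have hTcard : T.card = P.d * n ^ P.d := by
    rw [hT, Finset.card_product, Finset.card_univ, Fintype.card_fin, Fintype.card_piFinset]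
    simp
  rw [← hTcard]
  refine Finset.card_le_card_of_injOn (fun b => (b.dir, fun k => (b.src k - x₀ k).val)) (fun b hb => ?_) ?_
  · simp only [Finset.coe_filter, Finset.mem_univ, true_and, Set.mem_setOf_eq] at hb
    simp only [hT, Finset.coe_product, Finset.coe_univ, Fintype.coe_piFinset, Finset.coe_range, Set.mem_prod, Set.mem_univ,
      Set.mem_pi, Set.mem_Iio, true_and]
    exact fun k _ => hb k
  · intro b _ b' _ h
    simp only [Prod.mk.injEq] at h
    obtain ⟨hdir, hsrc⟩ := h
    have hs : b.src = b'.src := by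
      funext k
      have hk := congr_fun hsrc k
      have : b.src k - x₀ k = b'.src k - x₀ k := ZMod.val_injective _ hk
      simpa using this
    cases b; cases b'
    simp only at hdir hs
    rw [hs, hdir]

/-- The plaquettes based in the K1 box number at most `d² · n^d`. [folklore] -/
theorem card_filter_plaq_box_le (x₀ : Site P j) (n : ℕ) [DecidablePred fun q : Plaq P j => ∀ k, (q.src k - x₀ k).val < n] :
    (Finset.univ.filter fun q : Plaq P j => ∀ k, (q.src k - x₀ k).val < n).card ≤ P.d ^ 2 * n ^ P.d := by
  classical
  set T : Finset ((Fin P.d × Fin P.d) × (Fin P.d → ℕ)) := Finset.univ ×ˢ Fintype.piFinset fun _ => Finset.range n with hT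
  have hTcard : T.card = P.d ^ 2 * n ^ P.d := by
    rw [hT, Finset.card_product, Finset.card_univ, Fintype.card_prod, Fintype.card_fin, Fintype.card_piFinset]
    simp [sq]
  rw [← hTcard]
  refine Finset.card_le_card_of_injOn (fun q => ((q.μ, q.ν), fun k => (q.src k - x₀ k).val)) (fun q hq => ?_) ?_
  · simp only [Finset.coe_filter, Finset.mem_univ, true_and, Set.mem_setOf_eq] at hq
    simp only [hT, Finset.coe_product, Finset.coe_univ, Fintype.coe_piFinset, Finset.coe_range, Set.mem_prod, Set.mem_univ,
      Set.mem_pi, Set.mem_Iio, true_and]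
    exact fun k _ => hq k
  · intro q _ q' _ h
    simp only [Prod.mk.injEq] at h
    obtain ⟨⟨hμ, hν⟩, hsrc⟩ := h
    have hs : q.src = q'.src := by
      funext k
      have hk := congr_fun hsrc k
      have : q.src k - x₀ k = q'.src k - x₀ k := ZMod.val_injective _ hk
      simpa using this
    cases q; cases q'
    simp only at hμ hν hs
    subst hμ; subst hν; subst hs
    rfl

/-! ## §3 Locality + gauge invariance + Lipschitz ⇒ control by the box plaquettes -/

variable {G : Type*} [GaugeGroup G]

/-- ★★ **A LOCAL GAUGE-INVARIANT LIPSCHITZ OBSERVABLE IS CONTROLLED BY THE BOX PLAQUETTES.**  Let `f` be gauge invariant, depend only on the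
bonds with both ends in the K1 box of corner `x₀` and side `n` (`1 ≤ n`, `2n ≤ sitesPerDir`), and be `Λ`-Lipschitz in the `ℓ²` link metric.  If every
plaquette based in the box is within `δ` of `1`, then `|f U − f 1| ≤ Λ · (√(d·n^d) · ((d−1)(n−1))) · δ`: in the axial gauge of the box every box bond is
within `(d−1)(n−1)δ` of `1` (`T4AxialGaugeSmallField`), the gauge copy truncated to `1` off the box has the same `f`, and it is within
`√(#box bonds)·(d−1)(n−1)δ` of the trivial field in the link metric. [folklore] -/
theorem abs_sub_apply_one_le_of_box_plaqSmall (x₀ : Site P j) {n : ℕ} (hn : 1 ≤ n) (h2n : 2 * n ≤ P.sitesPerDir j)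
    (f : GaugeField P j G → ℝ) {Λ : ℝ} (hΛ : 0 ≤ Λ) (hinv : GaugeField.GaugeInvariant f)
    (hloc : ∀ U U' : GaugeField P j G, (∀ b : PBond P j, (∀ k, (b.src k - x₀ k).val < n) → (∀ k, (b.tgt k - x₀ k).val < n) →
      U b = U' b) → f U = f U')
    (hLip : ∀ U U' : GaugeField P j G, |f U - f U'| ≤ Λ * Real.sqrt (∑ b : PBond P j, dist1 (U b * (U' b)⁻¹) ^ 2))
    {δ : ℝ} (hδ : 0 ≤ δ) (U : GaugeField P j G)
    (hU : ∀ q : Plaq P j, (∀ k, (q.src k - x₀ k).val < n) → dist1 (GaugeField.plaqHol U q) < δ) :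
    |f U - f 1| ≤ Λ * (Real.sqrt ((P.d : ℝ) * (n : ℝ) ^ P.d) * ((((P.d - 1 : ℕ) : ℝ)) * (((n - 1 : ℕ) : ℝ)))) * δ := by
  classical
  -- the integer box and the axial gauge
  set lo : Fin P.d → ℤ := fun κ => ((x₀ κ).val : ℤ) with hlo
  set hi : Fin P.d → ℤ := fun κ => ((x₀ κ).val : ℤ) + ((n - 1 : ℕ) : ℤ) with hhi
  have hnle : ∀ κ, hi κ ≤ lo κ + ((n - 1 : ℕ) : ℤ) := fun κ => le_rfl
  have hnN : n - 1 < P.sitesPerDir j := by omega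
  have hsmall : PlaqSmallOn (boxPlaqs lo hi) δ U := fun q hq => hU q (val_lt_of_mem_boxPlaqs x₀ hn h2n hq)
  set u := axialGauge U lo hi with hu
  set W := GaugeField.gaugeAct u U with hW
  set C : ℝ := (((P.d - 1 : ℕ) : ℝ)) * (((n - 1 : ℕ) : ℝ)) * δ with hC
  have hC0 : 0 ≤ C := by positivity
  have hbond : ∀ b : PBond P j, (∀ k, (b.src k - x₀ k).val < n) → (∀ k, (b.tgt k - x₀ k).val < n) → dist1 (W b) ≤ C := by
    intro b hs ht
    have h := dist1_gaugeAct_axialGauge_le_of_mem_boxBonds U subset_rfl hsmall hδ hnle hnN (mem_boxBonds_of_val_lt x₀ hn h2n b hs ht)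
    simpa [hW, hu, hC, mul_assoc] using h
  -- the truncated gauge copy
  set box : PBond P j → Prop := fun b => (∀ k, (b.src k - x₀ k).val < n) ∧ ∀ k, (b.tgt k - x₀ k).val < n with hbox
  set V : GaugeField P j G := fun b => if box b then W b else 1 with hV
  have hfU : f U = f V := by
    rw [← hinv u U]
    refine hloc _ _ fun b hs ht => ?_
    simp only [hV, hbox, if_pos (And.intro hs ht), hW]
  -- its distance to the trivial field, bond by bond
  have hVb : ∀ b : PBond P j, dist1 (V b * ((1 : GaugeField P j G) b)⁻¹) ^ 2 ≤ if box b then C ^ 2 else 0 := by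
    intro b
    have h1 : (1 : GaugeField P j G) b = 1 := rfl
    rw [h1, inv_one, mul_one]
    by_cases hb : box b
    · rw [hV]; simp only [hb, if_true]
      exact pow_le_pow_left₀ (GaugeGroup.dist1_nonneg _) (hbond b hb.1 hb.2) 2
    · rw [hV]; simp only [hb, if_false, GaugeGroup.dist1_one]; simp
  have hsum : ∑ b : PBond P j, dist1 (V b * ((1 : GaugeField P j G) b)⁻¹) ^ 2 ≤ ((P.d : ℝ) * (n : ℝ) ^ P.d) * C ^ 2 := by
    calc ∑ b : PBond P j, dist1 (V b * ((1 : GaugeField P j G) b)⁻¹) ^ 2 ≤ ∑ b : PBond P j, (if box b then C ^ 2 else 0) :=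
          Finset.sum_le_sum fun b _ => hVb b
      _ = ((Finset.univ.filter box).card : ℝ) * C ^ 2 := by
          rw [Finset.sum_ite, Finset.sum_const_zero, add_zero, Finset.sum_const, nsmul_eq_mul]
      _ ≤ ((Finset.univ.filter fun b : PBond P j => ∀ k, (b.src k - x₀ k).val < n).card : ℝ) * C ^ 2 := by
          refine mul_le_mul_of_nonneg_right ?_ (sq_nonneg _)
          have hsub : Finset.univ.filter box ⊆ Finset.univ.filter fun b : PBond P j => ∀ k, (b.src k - x₀ k).val < n := by
            intro b hb
            simp only [Finset.mem_filter, Finset.mem_univ, true_and] at hb ⊢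
            exact hb.1
          exact_mod_cast Finset.card_le_card hsub
      _ ≤ ((P.d * n ^ P.d : ℕ) : ℝ) * C ^ 2 := by
          refine mul_le_mul_of_nonneg_right ?_ (sq_nonneg _)
          exact_mod_cast card_filter_bond_box_le x₀ n
      _ = ((P.d : ℝ) * (n : ℝ) ^ P.d) * C ^ 2 := by push_cast; ring
  have hsqrt : Real.sqrt (∑ b : PBond P j, dist1 (V b * ((1 : GaugeField P j G) b)⁻¹) ^ 2) ≤
      Real.sqrt ((P.d : ℝ) * (n : ℝ) ^ P.d) * C := by
    calc Real.sqrt (∑ b : PBond P j, dist1 (V b * ((1 : GaugeField P j G) b)⁻¹) ^ 2)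
          ≤ Real.sqrt (((P.d : ℝ) * (n : ℝ) ^ P.d) * C ^ 2) := Real.sqrt_le_sqrt hsum
      _ = Real.sqrt ((P.d : ℝ) * (n : ℝ) ^ P.d) * C := by rw [Real.sqrt_mul (by positivity), Real.sqrt_sq hC0]
  calc |f U - f 1| = |f V - f 1| := by rw [hfU]
    _ ≤ Λ * Real.sqrt (∑ b : PBond P j, dist1 (V b * ((1 : GaugeField P j G) b)⁻¹) ^ 2) := hLip V 1
    _ ≤ Λ * (Real.sqrt ((P.d : ℝ) * (n : ℝ) ^ P.d) * C) := mul_le_mul_of_nonneg_left hsqrt hΛ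
    _ = Λ * (Real.sqrt ((P.d : ℝ) * (n : ℝ) ^ P.d) * ((((P.d - 1 : ℕ) : ℝ)) * (((n - 1 : ℕ) : ℝ)))) * δ := by rw [hC]; ring

end Summit.QuantumFields.YangMills.Theorems.LocalInsertion.BoxAxialLipschitz

end
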